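import Mathlib
import HarnessLib.Audit
import Summits.PneNP.PneNP.Theorems.PstarGraphQuadGap
import Summits.PneNP.PneNP.Theorems.PstarRankRigidityTwo
import Summits.PneNP.PneNP.Theorems.PstarRankRigidityThree

/-!
# Edge sums of rank two are complete tripartite (ROUND-24, GAPTWO-PLAN v1 S4b (b6) / memo §9 R3)

FRONTIER range-avoidance ladder, rung F-N3, ROUND 24 (cell `pnp-ideate`, planner memo `r24/CORE-BOUND-NOTES.md` §4/§9 R3, sub-lemma (b6) of
`r24/GAPTWO-PLAN.md` v1 §6.3; restricted-model proof complexity — nothing here bears on `P` versus `NP`).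

For a simple graph `T` on `Fin V` (increasing pairs, `PstarGraphQuadGap.Simple`) the polar form `B_T` of the edge sum `Σ_{(p,q)∈T} a_p a_q` is its
adjacency form: `B_T e_p e_q = [p ~ q]` (`polar_single_single`).  If `B_T` has RANK TWO (`B_T a b = 1` and radical of codimension `≤ 2`) then
by `PstarRankRigidityThree.rank_two_structure` `B_T x y = u x · ℓ y + u y · ℓ x` with `u = B_T(·, b)`, `ℓ = B_T(·, a)`; labelling each vertex by
`(u e_p, ℓ e_p) ∈ 𝔽₂²`:

* `adj_iff_labels` — `p ~ q ↔ u_p ℓ_q + u_q ℓ_p = 1`, i.e. (`adj_iff_labels_ne`) **`p ~ q` iff the labels of `p, q` are non-zero and different**: the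
  graph is COMPLETE TRIPARTITE on the three classes of non-zero labels (complete bipartite when one class is empty), vertices of label `0` isolated.
  Consequences used by R3: no edge inside a label class (`not_adj_of_labels_eq`), any two non-isolated vertices with different labels are adjacent
  — so two vertex-disjoint edges are never induced (an edge sum containing an induced `2K₂` has rank `≥ 4`,
  cf. `PstarProductRank.IsInducedMatching.finrank_add_card_le`).
* `finrank_le_rad_of_labels` — conversely, a graph whose adjacency is given by labels in this way has `B_T = u ⊗ ℓ + ℓ ⊗ u`, rank `≤ 2`.
-/

set_option linter.dupNamespace false -- `Summit.PneNP.PneNP.…`: summit = sub-problem name (D-0017 single-conjunct layout)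

open Finset Module
open Summit.PneNP.PneNP.Theorems.PstarProductRank (polar polar_apply)
open Summit.PneNP.PneNP.Theorems.PstarGraphQuadGap (Edge Simple)
open Summit.PneNP.PneNP.Theorems.PstarQuadRank (rad mem_rad)
open Summit.PneNP.PneNP.Theorems.PstarRankRigidityTwo (symForm symForm_apply finrank_le_rad_symForm)
open Summit.PneNP.PneNP.Theorems.PstarRankRigidityThree (rank_two_structure)

namespace Summit.PneNP.PneNP.Theorems.PstarEdgeRankTwo

/-- Every element of `𝔽₂` is `0` or `1`. -/
private theorem zmod2_cases (t : ZMod 2) : t = 0 ∨ t = 1 := by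
  revert t; decide

/-- In `𝔽₂`, `x + x = 0`. -/
private theorem zmod2_add_self (x : ZMod 2) : x + x = 0 := by
  revert x; decide

variable {V : ℕ}

-- Throughout, `p ~ q` means `(p, q) ∈ T ∨ (q, p) ∈ T` and `e_p = Pi.single p 1` is the standard basis vector of `𝔽₂^V`.

/-! ## The adjacency form -/

/-- The polar form of an edge sum is alternating. -/
theorem polar_self_edge (T : Finset (Edge V)) (x : Fin V → ZMod 2) : polar T Prod.fst Prod.snd x x = 0 := by
  rw [polar_apply]
  exact sum_eq_zero fun e _ => by rw [mul_comm (x e.2) (x e.1)]; exact zmod2_add_self _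

/-- The polar form of an edge sum is symmetric. -/
theorem polar_symm_edge (T : Finset (Edge V)) (x y : Fin V → ZMod 2) :
    polar T Prod.fst Prod.snd x y = polar T Prod.fst Prod.snd y x := by
  rw [polar_apply, polar_apply]
  exact sum_congr rfl fun e _ => by ring

/-- Product of two indicators. -/
private theorem ind_mul (P Q : Prop) [Decidable P] [Decidable Q] :
    ((if P then (1 : ZMod 2) else 0) * if Q then 1 else 0) = if P ∧ Q then 1 else 0 := by
  by_cases hP : P <;> by_cases hQ : Q <;> simp [hP, hQ]

/-- **`B_T e_p e_q = [p ~ q]`** for a simple graph. -/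
theorem polar_single_single {T : Finset (Edge V)} (hS : Simple T) (p q : Fin V) :
    polar T Prod.fst Prod.snd (Pi.single p (1 : ZMod 2)) (Pi.single q (1 : ZMod 2)) =
      if ((p, q) ∈ T ∨ (q, p) ∈ T) then 1 else 0 := by
  classical
  rw [polar_apply]
  have hterm : ∀ e ∈ T,
      ((Pi.single p 1 : Fin V → ZMod 2) e.1 * (Pi.single q 1 : Fin V → ZMod 2) e.2 +
        (Pi.single p 1 : Fin V → ZMod 2) e.2 * (Pi.single q 1 : Fin V → ZMod 2) e.1) =
      (if e = (p, q) then 1 else 0) + (if e = (q, p) then 1 else 0) := by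
    intro e _
    obtain ⟨e1, e2⟩ := e
    simp only [Pi.single_apply, Prod.mk.injEq]
    rw [mul_comm (if e2 = p then (1 : ZMod 2) else 0), ind_mul, ind_mul]
  rw [sum_congr rfl hterm, sum_add_distrib]
  simp only [sum_ite_eq']
  by_cases hpq : (p, q) ∈ T
  · have hqp : (q, p) ∉ T := fun hqp => absurd (lt_trans (hS _ hpq) (hS _ hqp)) (lt_irrefl _)
    rw [if_pos hpq, if_neg hqp, if_pos (Or.inl hpq), add_zero]
  · by_cases hqp : (q, p) ∈ T
    · rw [if_neg hpq, if_pos hqp, if_pos (Or.inr hqp), zero_add]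
    · rw [if_neg hpq, if_neg hqp, add_zero, if_neg (by rintro (h | h) <;> contradiction)]

/-! ## Rank two ⇒ labels -/

section RankTwo

variable {T : Finset (Edge V)} (hS : Simple T) {a b : Fin V → ZMod 2} (hab : polar T Prod.fst Prod.snd a b = 1)
  (hrank : finrank (ZMod 2) (Fin V → ZMod 2) ≤ finrank (ZMod 2) (rad (polar T Prod.fst Prod.snd)) + 2)

include hS hab hrank

/-- **Adjacency from labels.**  With `u_p = B_T e_p b`, `ℓ_p = B_T e_p a`: `p ~ q ↔ u_p ℓ_q + u_q ℓ_p = 1`. -/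
theorem adj_iff_labels (p q : Fin V) :
    ((p, q) ∈ T ∨ (q, p) ∈ T) ↔
      polar T Prod.fst Prod.snd (Pi.single p (1 : ZMod 2)) b * polar T Prod.fst Prod.snd (Pi.single q (1 : ZMod 2)) a +
        polar T Prod.fst Prod.snd (Pi.single q (1 : ZMod 2)) b * polar T Prod.fst Prod.snd (Pi.single p (1 : ZMod 2)) a = 1 := by
  classical
  have h := rank_two_structure (polar_self_edge T) (polar_symm_edge T) hab hrank (Pi.single p (1 : ZMod 2))
    (Pi.single q (1 : ZMod 2))
  rw [polar_single_single hS] at h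
  by_cases hA : ((p, q) ∈ T ∨ (q, p) ∈ T)
  · rw [if_pos hA] at h; exact ⟨fun _ => h.symm, fun _ => hA⟩
  · rw [if_neg hA] at h
    refine ⟨fun h' => absurd h' hA, fun h' => ?_⟩
    rw [← h] at h'; exact absurd h' zero_ne_one

/-- **Complete tripartite structure**: `p ~ q` iff the labels `(u_p, ℓ_p)`, `(u_q, ℓ_q)` are both non-zero and different. -/
theorem adj_iff_labels_ne (p q : Fin V) :
    ((p, q) ∈ T ∨ (q, p) ∈ T) ↔
      (polar T Prod.fst Prod.snd (Pi.single p (1 : ZMod 2)) b, polar T Prod.fst Prod.snd (Pi.single p (1 : ZMod 2)) a) ≠ (0, 0) ∧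
      (polar T Prod.fst Prod.snd (Pi.single q (1 : ZMod 2)) b, polar T Prod.fst Prod.snd (Pi.single q (1 : ZMod 2)) a) ≠ (0, 0) ∧
      (polar T Prod.fst Prod.snd (Pi.single p (1 : ZMod 2)) b, polar T Prod.fst Prod.snd (Pi.single p (1 : ZMod 2)) a) ≠
        (polar T Prod.fst Prod.snd (Pi.single q (1 : ZMod 2)) b, polar T Prod.fst Prod.snd (Pi.single q (1 : ZMod 2)) a) := by
  rw [adj_iff_labels hS hab hrank]
  generalize polar T Prod.fst Prod.snd (Pi.single p (1 : ZMod 2)) b = up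
  generalize polar T Prod.fst Prod.snd (Pi.single p (1 : ZMod 2)) a = lp
  generalize polar T Prod.fst Prod.snd (Pi.single q (1 : ZMod 2)) b = uq
  generalize polar T Prod.fst Prod.snd (Pi.single q (1 : ZMod 2)) a = lq
  revert up lp uq lq
  decide

/-- No edge inside a label class. -/
theorem not_adj_of_labels_eq {p q : Fin V}
    (h : (polar T Prod.fst Prod.snd (Pi.single p (1 : ZMod 2)) b, polar T Prod.fst Prod.snd (Pi.single p (1 : ZMod 2)) a) =
      (polar T Prod.fst Prod.snd (Pi.single q (1 : ZMod 2)) b, polar T Prod.fst Prod.snd (Pi.single q (1 : ZMod 2)) a)) :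
    ¬ ((p, q) ∈ T ∨ (q, p) ∈ T) := by
  rw [adj_iff_labels_ne hS hab hrank]
  exact fun h' => h'.2.2 h

/-- Non-isolated vertices with different labels are adjacent. -/
theorem adj_of_labels_ne {p q : Fin V}
    (hp : (polar T Prod.fst Prod.snd (Pi.single p (1 : ZMod 2)) b, polar T Prod.fst Prod.snd (Pi.single p (1 : ZMod 2)) a) ≠ (0, 0))
    (hq : (polar T Prod.fst Prod.snd (Pi.single q (1 : ZMod 2)) b, polar T Prod.fst Prod.snd (Pi.single q (1 : ZMod 2)) a) ≠ (0, 0))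
    (hne : (polar T Prod.fst Prod.snd (Pi.single p (1 : ZMod 2)) b, polar T Prod.fst Prod.snd (Pi.single p (1 : ZMod 2)) a) ≠
      (polar T Prod.fst Prod.snd (Pi.single q (1 : ZMod 2)) b, polar T Prod.fst Prod.snd (Pi.single q (1 : ZMod 2)) a)) :
    ((p, q) ∈ T ∨ (q, p) ∈ T) :=
  (adj_iff_labels_ne hS hab hrank p q).2 ⟨hp, hq, hne⟩

/-- A vertex on some edge has a non-zero label. -/
theorem labels_ne_zero_of_adj {p q : Fin V} (h : ((p, q) ∈ T ∨ (q, p) ∈ T)) :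
    (polar T Prod.fst Prod.snd (Pi.single p (1 : ZMod 2)) b, polar T Prod.fst Prod.snd (Pi.single p (1 : ZMod 2)) a) ≠ (0, 0) :=
  ((adj_iff_labels_ne hS hab hrank p q).1 h).1

/-- **No induced `2K₂`**: two vertex-disjoint edges always have an edge between them. -/
theorem exists_cross_edge {p q p' q' : Fin V} (h : ((p, q) ∈ T ∨ (q, p) ∈ T)) (h' : ((p', q') ∈ T ∨ (q', p') ∈ T)) :
    ((p, p') ∈ T ∨ (p', p) ∈ T) ∨ ((p, q') ∈ T ∨ (q', p) ∈ T) ∨ ((q, p') ∈ T ∨ (p', q) ∈ T) ∨ ((q, q') ∈ T ∨ (q', q) ∈ T) := by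
  have e1 := (adj_iff_labels_ne hS hab hrank p q).1 h
  have e2 := (adj_iff_labels_ne hS hab hrank p' q').1 h'
  rw [adj_iff_labels hS hab hrank, adj_iff_labels hS hab hrank, adj_iff_labels hS hab hrank, adj_iff_labels hS hab hrank]
  revert e1 e2
  generalize polar T Prod.fst Prod.snd (Pi.single p (1 : ZMod 2)) b = up
  generalize polar T Prod.fst Prod.snd (Pi.single p (1 : ZMod 2)) a = lp
  generalize polar T Prod.fst Prod.snd (Pi.single q (1 : ZMod 2)) b = uq
  generalize polar T Prod.fst Prod.snd (Pi.single q (1 : ZMod 2)) a = lq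
  generalize polar T Prod.fst Prod.snd (Pi.single p' (1 : ZMod 2)) b = up'
  generalize polar T Prod.fst Prod.snd (Pi.single p' (1 : ZMod 2)) a = lp'
  generalize polar T Prod.fst Prod.snd (Pi.single q' (1 : ZMod 2)) b = uq'
  generalize polar T Prod.fst Prod.snd (Pi.single q' (1 : ZMod 2)) a = lq'
  revert up lp uq lq up' lp' uq' lq'
  decide

end RankTwo

/-! ## Labels ⇒ rank at most two -/

/-- **A label graph has rank at most two**: if `p ~ q ↔ u_p ℓ_q + u_q ℓ_p = 1` then `B_T = u ⊗ ℓ + ℓ ⊗ u` and its radical has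
codimension `≤ 2`. -/
theorem finrank_le_rad_of_labels {T : Finset (Edge V)} (hS : Simple T) (u ℓ : Fin V → ZMod 2)
    (hadj : ∀ p q, ((p, q) ∈ T ∨ (q, p) ∈ T) ↔ u p * ℓ q + u q * ℓ p = 1) :
    finrank (ZMod 2) (Fin V → ZMod 2) ≤ finrank (ZMod 2) (rad (polar T Prod.fst Prod.snd)) + 2 := by
  classical
  -- the two forms agree on the standard basis, hence everywhere
  have hbasis : ∀ p q, polar T Prod.fst Prod.snd (Pi.single p (1 : ZMod 2)) (Pi.single q (1 : ZMod 2)) =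
      symForm (Fintype.linearCombination (ZMod 2) u) (Fintype.linearCombination (ZMod 2) ℓ) (Pi.single p (1 : ZMod 2))
        (Pi.single q (1 : ZMod 2)) := by
    intro p q
    rw [polar_single_single hS, symForm_apply]
    have hw : ∀ (c : Fin V → ZMod 2) (r : Fin V), Fintype.linearCombination (ZMod 2) c (Pi.single r (1 : ZMod 2)) = c r :=
      fun c r => by rw [Fintype.linearCombination_apply_single, smul_eq_mul, one_mul]
    rw [hw, hw, hw, hw]
    by_cases h : ((p, q) ∈ T ∨ (q, p) ∈ T)
    · rw [if_pos h]; exact ((hadj p q).1 h).symm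
    · rw [if_neg h]
      rcases zmod2_cases (u p * ℓ q + u q * ℓ p) with e | e
      · exact e.symm
      · exact absurd ((hadj p q).2 e) h
  have heq : polar T Prod.fst Prod.snd =
      symForm (Fintype.linearCombination (ZMod 2) u) (Fintype.linearCombination (ZMod 2) ℓ) := by
    refine LinearMap.ext_basis (Pi.basisFun (ZMod 2) (Fin V)) (Pi.basisFun (ZMod 2) (Fin V)) fun p q => ?_
    rw [Pi.basisFun_apply, Pi.basisFun_apply]
    exact hbasis p q
  rw [heq]
  exact finrank_le_rad_symForm _ _

end Summit.PneNP.PneNP.Theorems.PstarEdgeRankTwo
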